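import Summits.CriticalPhenomena.SAWScalingLimit.Theorems.SAWDevelopingMapObservableToSLETypeLadderCarvedReductionAssembly
import Summits.CriticalPhenomena.SAWScalingLimit.Theorems.SAWDefectDecoherenceObservableToSLERNestedGateDefs
import Summits.CriticalPhenomena.SAWScalingLimit.Theorems.SAWDefectDecoherenceObservableToSLERNestedLinkDefs
import Summits.CriticalPhenomena.SAWScalingLimit.Theorems.ObservableToSLE.Negative.Identification
import HarnessLib

/-!
# Crux `SAWDevelopingMap.ObservableToSLE` (stmt-CriticalPhenomena-10472), line `six-class-type-ladder`,
stub T2c `stub_carvedReduction_assemblyP`: THE ASSEMBLY, GENERIC IN THE FAMILY BLOCK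
`∀ P, MovingCarvingSqueezeP P → TwoPieceAdmIdentification → SLELawContinuity → CarvedSeqIdentificationPM P`

Landing target:
`Summits/CriticalPhenomena/SAWScalingLimit/Theorems/SAWDevelopingMapObservableToSLETypeLadderCarvedReductionAssemblyP.lean`
(`--supports stmt-CriticalPhenomena-10472`; registered stub `stub_carvedReduction_assemblyP`).

The landed assembly `stub_carvedReduction_assembly` (file `…TypeLadderCarvedReductionAssembly`)
proves `MovingCarvingSqueeze → TwoPieceAdmIdentification → SLELawContinuity →
CarvedSeqIdentificationPM FatAnchoredClassZero`; its proof hands the per-index FAMILY BLOCK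
(exterior anchoring, clean-window half-plane structure, fat bodies) ONLY to the squeeze hypothesis.
Hence the same argument proves the assembly with the family block replaced — in the squeeze
hypothesis and in the conclusion alike — by an arbitrary predicate
`P D a b (δ k) ρ R N (S k) (T k)`.  This is that generic re-statement; the proof is the landed one
verbatim (contradiction along a bad subsequence; squeeze package at level
`ε' = min(1/2, ε/(16(‖f‖+1)))`; the pinned DCS laws of `(Λ'(δ_j); a', b')` are eventually
probability, TIGHT and carry a UNIFORM MODULUS, and the carved `f`-integrals are `2‖f‖ε'`-close
to their translated integrals (`core_transport`, `core_transport_event`); every weak subsequential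
limit is SLE(8/3) in `M` by T2a, its translate is SLE(8/3) in `M + τ`, `ε/2`-close to `ν` by
`SLELawContinuity` (`stub_carvedReduction_continuityStep`); `exists_close_of_weakLimits`
(Prokhorov + Slutsky) gives a good index on the bad subsequence).  Registered sub-goal:
`stub_carvedReduction_assemblyP_level` (the squeeze level, piece (G0)).
-/

noncomputable section

open scoped BigOperators Topology NNReal ENNReal Classical BoundedContinuousFunction
open Filter Set MeasureTheory Metric
open Literature.Probability.LatticeModels (HexVertex hexGraph hexCenter triZeta triEmbed Site polyline)
open Literature.Probability.RandomPlanarGeometry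
open Literature.Probability.RandomPlanarGeometry.SAW
open UpperHalfPlane (upperHalfPlaneSet)

namespace Summit.CriticalPhenomena.SAWScalingLimit.Theorems.ObservableToSLE.TypeLadder

open Summit.CriticalPhenomena.SAWScalingLimit.Theorems.ObservableToSLER.BridgeGate
open Summit.CriticalPhenomena.SAWScalingLimit.Theorems.ObservableToSLER.NestedGate
open Summit.CriticalPhenomena.SAWScalingLimit.Theorems.ObservableToSLER.TwoPiece
  (dcsMass_pos integral_dcsLaw dcsLaw_apply isProbabilityMeasure_dcsLaw)
open Summit.CriticalPhenomena.SAWScalingLimit.Theorems.ObservableToSLE.Negative (finite_hexDomainSAW)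

/-- **Registered sub-goal `stub_carvedReduction_assemblyP_level`** (the SQUEEZE LEVEL of the assembly,
piece (G0)): for `c = ‖f‖ ≥ 0` and `ε > 0` the level `ε' = min (1/2) (ε / (16 (c + 1)))` at which the
moving-carving squeeze is invoked is positive, `< 1`, and satisfies `2 c ε' ≤ ε / 8`. -/
theorem stub_carvedReduction_assemblyP_level :
    ∀ (c ε : ℝ), 0 ≤ c → 0 < ε →
      0 < min (1 / 2) (ε / (16 * (c + 1))) ∧ min (1 / 2) (ε / (16 * (c + 1))) < 1 ∧
        2 * c * min (1 / 2) (ε / (16 * (c + 1))) ≤ ε / 8 := by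
  intro c ε hc hε
  refine ⟨lt_min (by norm_num) (by positivity), (min_le_left _ _).trans_lt (by norm_num), ?_⟩
  refine (mul_le_mul_of_nonneg_left (min_le_right _ _) (by positivity)).trans ?_
  rw [mul_div_assoc', div_le_div_iff₀ (by positivity) (by norm_num)]
  nlinarith [hc, hε.le]

/-- **THE GENERIC ASSEMBLY `stub_carvedReduction_assemblyP`** (crux item stmt-CriticalPhenomena-10472,
stub T2c): for every family-block predicate `P`,
`MovingCarvingSqueezeP P → TwoPieceAdmIdentification → SLELawContinuity → CarvedSeqIdentificationPM P`
(all inlined).  The landed `stub_carvedReduction_assembly` is the instance `P = FatAnchoredClassZero`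
block; the proof below is its proof verbatim, since the family block is only handed to the squeeze. -/
theorem stub_carvedReduction_assemblyP :
    ∀ (P : DobrushinDomain → (ℝ → HexVertex) → (ℝ → HexVertex) → ℝ → ℝ → ℝ → ℕ →
      (ℕ → Set HexVertex) → (ℕ → Set HexVertex) → Prop),
    (∀ (D : DobrushinDomain) (a b : ℝ → HexVertex), IsEmbEndpointApprox hexGraph hexCenter D a b →
      ∀ η > (0 : ℝ), ∃ R₀ > (0 : ℝ), ∀ R ∈ Set.Ioc (0 : ℝ) R₀, ∀ ρ > (0 : ℝ), ∀ N : ℕ,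
          ∀ (δ : ℕ → ℝ) (S T : ℕ → ℕ → Set HexVertex) (n n' : ℕ → ℕ) (q q' : ℕ → HexVertex),
            Tendsto δ atTop (𝓝[>] 0) →
            (∀ k, TameNestedFamily (δ k) R N (a (δ k)) (S k) ∧
              TameNestedFamily (δ k) R N (b (δ k)) (T k) ∧
              P D a b (δ k) ρ R N (S k) (T k)) →
            (∀ k, ∃ (γ : HexDomainSAW D.carrier (δ k) (a (δ k)) (b (δ k))) (m : ℕ) (p : HexVertex)
                (m' : ℕ) (p' : HexVertex),
              IsFirstGoodGateN D.carrier (δ k) ρ R (S k) (a (δ k)) γ.walk.support (n k) m p (q k) ∧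
              IsFirstGoodGateN D.carrier (δ k) ρ R (T k) (b (δ k)) γ.walk.support.reverse
                (n' k) m' p' (q' k) ∧
              WideLink D.carrier (δ k) ρ (S k (n k) ∪ T k (n' k)) (q k) (q' k)) →
            ∀ ε' > (0 : ℝ), ∀ φ : ℕ → ℕ, StrictMono φ →
              ∃ (ψ : ℕ → ℕ) (M : DobrushinDomain) (τ : ℂ) (ρ' : ℝ) (Λ' : ℝ → Finset HexVertex)
                (m : Fin 2 → ℝ → ℤ) (a' b' : ℝ → Sym2 HexVertex) (x : ℕ → Site 2)
                (Λ'' : ℕ → Finset HexVertex) (pu pv : ℕ → HexVertex),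
                StrictMono ψ ∧
                (∀ t : ℝ, dist (M.boundary t + τ) (D.boundary t) ≤ η) ∧
                dist (M.pt 0 + τ) (D.pt 0) ≤ η ∧ dist (M.pt 1 + τ) (D.pt 1) ≤ η ∧
                (0 < ρ' ∧ ∀ i : Fin 2,
                  M.carrier ∩ ball (M.pt i) ρ' = {z : ℂ | (M.pt i).im < z.im} ∩ ball (M.pt i) ρ') ∧
                (∀ᶠ δ' : ℝ in 𝓝[>] 0, hexDomainSimplyConnected (Λ' δ') ∧
                  a' δ' ∈ hexDomainBoundary (Λ' δ') ∧ b' δ' ∈ hexDomainBoundary (Λ' δ') ∧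
                  Nonempty (HexMidEdgeSAW (Λ' δ') (a' δ') (b' δ')) ∧
                  (hexGraph.induce (↑(Λ' δ') : Set HexVertex)).Preconnected ∧
                  (∀ v ∈ Λ' δ', (δ' : ℂ) * hexCenter v ∈ M.carrier) ∧
                  (∀ i : Fin 2, ∀ v : HexVertex, (δ' : ℂ) * hexCenter v ∈ ball (M.pt i) ρ' →
                    (v ∈ Λ' δ' ↔ m i δ' ≤ v.1 1))) ∧
                (∀ K : Set ℂ, IsCompact K → K ⊆ M.carrier →
                  ∀ᶠ δ' : ℝ in 𝓝[>] 0, ∀ v : HexVertex, (δ' : ℂ) * hexCenter v ∈ K → v ∈ Λ' δ') ∧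
                Tendsto (fun δ' : ℝ => (δ' : ℂ) * hexMidpoint (a' δ')) (𝓝[>] 0) (𝓝 (M.pt 0)) ∧
                Tendsto (fun δ' : ℝ => (δ' : ℂ) * hexMidpoint (b' δ')) (𝓝[>] 0) (𝓝 (M.pt 1)) ∧
                Tendsto (fun j : ℕ => ((δ (φ (ψ j)) : ℝ) : ℂ) *
                  Literature.Probability.LatticeModels.triEmbed (x j)) atTop (𝓝 τ) ∧
                (∀ j : ℕ,
                  (∀ w : HexVertex, w ∈ Λ'' j ↔ ((-(x j) + w.1, w.2) : HexVertex) ∈ Λ' (δ (φ (ψ j)))) ∧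
                  (∀ w ∈ Λ'' j, w ∉ S (φ (ψ j)) (n (φ (ψ j))) ∪ T (φ (ψ j)) (n' (φ (ψ j)))) ∧
                  (∀ w ∈ Λ'' j, ∀ y ∈ Λ'' j, hexGraph.Adj w y →
                    (hexDomainGraph D.carrier (δ (φ (ψ j)))).Adj w y) ∧
                  q (φ (ψ j)) ∈ Λ'' j ∧
                  pu j ∈ S (φ (ψ j)) (n (φ (ψ j))) ∪ T (φ (ψ j)) (n' (φ (ψ j))) ∧
                  pv j ∈ S (φ (ψ j)) (n (φ (ψ j))) ∪ T (φ (ψ j)) (n' (φ (ψ j))) ∧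
                  hexGraph.Adj (q (φ (ψ j))) (pu j) ∧
                  s(q (φ (ψ j)), pu j) ≠ s(q' (φ (ψ j)), pv j) ∧
                  (a' (δ (φ (ψ j)))).map (fun w : HexVertex => ((x j + w.1, w.2) : HexVertex)) =
                    s(q (φ (ψ j)), pu j) ∧
                  (b' (δ (φ (ψ j)))).map (fun w : HexVertex => ((x j + w.1, w.2) : HexVertex)) =
                    s(q' (φ (ψ j)), pv j)) ∧
                (∀ᶠ j : ℕ in atTop, 1 - ε' ≤
                  (carvedLaw D.carrier (δ (φ (ψ j))) (S (φ (ψ j)) (n (φ (ψ j))) ∪ T (φ (ψ j)) (n' (φ (ψ j))))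
                    (q (φ (ψ j))) (q' (φ (ψ j))) {ξ | ∀ w ∈ ξ.walk.support, w ∈ Λ'' j}).toReal)) →
    (∀ (M : DobrushinDomain) (ρ : ℝ) (Λ : ℝ → Finset HexVertex) (m : Fin 2 → ℝ → ℤ)
      (a b : ℝ → Sym2 HexVertex),
      (0 < ρ ∧ ∀ i : Fin 2, M.carrier ∩ ball (M.pt i) ρ = {z : ℂ | (M.pt i).im < z.im} ∩ ball (M.pt i) ρ) →
      (∀ᶠ δ : ℝ in 𝓝[>] 0, hexDomainSimplyConnected (Λ δ) ∧ a δ ∈ hexDomainBoundary (Λ δ) ∧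
        b δ ∈ hexDomainBoundary (Λ δ) ∧ Nonempty (HexMidEdgeSAW (Λ δ) (a δ) (b δ)) ∧
        (hexGraph.induce (↑(Λ δ) : Set HexVertex)).Preconnected ∧
        (∀ v ∈ Λ δ, (δ : ℂ) * hexCenter v ∈ M.carrier) ∧
        (∀ i : Fin 2, ∀ v : HexVertex, (δ : ℂ) * hexCenter v ∈ ball (M.pt i) ρ →
          (v ∈ Λ δ ↔ m i δ ≤ v.1 1))) →
      (∀ K : Set ℂ, IsCompact K → K ⊆ M.carrier →
        ∀ᶠ δ : ℝ in 𝓝[>] 0, ∀ v : HexVertex, (δ : ℂ) * hexCenter v ∈ K → v ∈ Λ δ) →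
      Tendsto (fun δ : ℝ => (δ : ℂ) * hexMidpoint (a δ)) (𝓝[>] 0) (𝓝 (M.pt 0)) →
      Tendsto (fun δ : ℝ => (δ : ℂ) * hexMidpoint (b δ)) (𝓝[>] 0) (𝓝 (M.pt 1)) →
      ∀ (μ : Measure (CurveClass ℂ)) (s : ℕ → ℝ), IsProbabilityMeasure μ →
        Tendsto s atTop (𝓝[>] 0) →
        (∀ f : CurveClass ℂ →ᵇ ℝ,
          Tendsto (fun n =>
            (∑ γ : HexMidEdgeSAW (Λ (s n)) (a (s n)) (b (s n)),
                hexCriticalFugacity ^ γ.length *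
                  f (CurveClass.mk ⟨polyline (γ.verts.map fun v => ((s n : ℝ) : ℂ) * hexCenter v)⟩)) /
              (∑ γ : HexMidEdgeSAW (Λ (s n)) (a (s n)) (b (s n)), hexCriticalFugacity ^ γ.length))
            atTop (𝓝 (∫ x, f x ∂μ))) →
        (∀ ε η : ℝ, 0 < ε → 0 < η → ∃ θ : ℝ, 0 < θ ∧ ∀ᶠ n in atTop,
          (∑ γ : HexMidEdgeSAW (Λ (s n)) (a (s n)) (b (s n)),
              if CurveClass.mk ⟨polyline (γ.verts.map fun v => ((s n : ℝ) : ℂ) * hexCenter v)⟩ ∉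
                  CurveClass.modulusClass ε θ
              then hexCriticalFugacity ^ γ.length else 0) ≤
            η * ∑ γ : HexMidEdgeSAW (Λ (s n)) (a (s n)) (b (s n)), hexCriticalFugacity ^ γ.length) →
        IsSLELaw ((8 : ℝ≥0) / 3) M μ) →
    (∀ (D : DobrushinDomain) (f : CurveClass ℂ →ᵇ ℝ) (ε : ℝ), 0 < ε → ∃ η > (0 : ℝ),
       ∀ (M : DobrushinDomain), (∀ t : ℝ, dist (M.boundary t) (D.boundary t) ≤ η) →
         dist (M.pt 0) (D.pt 0) ≤ η → dist (M.pt 1) (D.pt 1) ≤ η →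
         ∀ μ ν : Measure (CurveClass ℂ), IsSLELaw ((8 : ℝ≥0) / 3) M μ → IsSLELaw ((8 : ℝ≥0) / 3) D ν →
           |∫ x, f x ∂μ - ∫ x, f x ∂ν| ≤ ε) →
    ∀ (D : DobrushinDomain) (a b : ℝ → HexVertex), IsEmbEndpointApprox hexGraph hexCenter D a b →
      ∀ (ν : Measure (CurveClass ℂ)), IsSLELaw ((8 : ℝ≥0) / 3) D ν →
      ∀ (f : CurveClass ℂ →ᵇ ℝ) (ε : ℝ), 0 < ε →
        ∃ R₀ > (0 : ℝ), ∀ R ∈ Set.Ioc (0 : ℝ) R₀, ∀ ρ > (0 : ℝ), ∀ N : ℕ,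
          ∀ (δ : ℕ → ℝ) (S T : ℕ → ℕ → Set HexVertex) (n n' : ℕ → ℕ) (q q' : ℕ → HexVertex),
            Tendsto δ atTop (𝓝[>] 0) →
            (∀ k, TameNestedFamily (δ k) R N (a (δ k)) (S k) ∧
              TameNestedFamily (δ k) R N (b (δ k)) (T k) ∧
              P D a b (δ k) ρ R N (S k) (T k)) →
            (∀ k, ∃ (γ : HexDomainSAW D.carrier (δ k) (a (δ k)) (b (δ k))) (m : ℕ) (p : HexVertex)
                (m' : ℕ) (p' : HexVertex),
              IsFirstGoodGateN D.carrier (δ k) ρ R (S k) (a (δ k)) γ.walk.support (n k) m p (q k) ∧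
              IsFirstGoodGateN D.carrier (δ k) ρ R (T k) (b (δ k)) γ.walk.support.reverse
                (n' k) m' p' (q' k) ∧
              WideLink D.carrier (δ k) ρ (S k (n k) ∪ T k (n' k)) (q k) (q' k)) →
            (∀ k, IsProbabilityMeasure
              (carvedLaw D.carrier (δ k) (S k (n k) ∪ T k (n' k)) (q k) (q' k))) →
            (∀ η > (0 : ℝ), ∃ 𝒦 : Set (CurveClass ℂ), IsCompact 𝒦 ∧ ∀ᶠ k in atTop,
              carvedLaw D.carrier (δ k) (S k (n k) ∪ T k (n' k)) (q k) (q' k)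
                {ξ | ξ.curve ∉ 𝒦} ≤ ENNReal.ofReal η) →
            (∀ ε' > (0 : ℝ), ∀ η > (0 : ℝ), ∃ θ > (0 : ℝ), ∀ᶠ k in atTop,
              carvedLaw D.carrier (δ k) (S k (n k) ∪ T k (n' k)) (q k) (q' k)
                {ξ | ξ.curve ∉ CurveClass.modulusClass ε' θ} ≤ ENNReal.ofReal η) →
            ∀ᶠ k in atTop,
              |(∫ ξ, f ξ.curve ∂(carvedLaw D.carrier (δ k) (S k (n k) ∪ T k (n' k)) (q k) (q' k))) -
                  ∫ x, f x ∂ν| ≤ ε := by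
  intro P hAtom hT2a hSLC D a b hab ν hν f ε hε
  obtain ⟨ηD, hηD, hcont⟩ := hSLC D f (ε / 2) (half_pos hε)
  obtain ⟨R₀, hR₀, hR⟩ := hAtom D a b hab ηD hηD
  refine ⟨R₀, hR₀, ?_⟩
  intro R hRmem ρ hρ N δ S T n n' q q' hδ hfam hgates hprob htight hmod
  by_contra hnot
  obtain ⟨φ, hφ, hbad⟩ := exists_strictMono_forall_of_not_eventually hnot
  obtain ⟨hε'pos, hε'lt, hε'le⟩ := stub_carvedReduction_assemblyP_level ‖f‖ ε (norm_nonneg f) hε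
  set ε' : ℝ := min (1 / 2) (ε / (16 * (‖f‖ + 1))) with hε'
  obtain ⟨ψ, M, τ, ρ', Λ', m, a', b', x, Λ'', pu, pv, hψ, hbd, hpt0, hpt1, hflat, hadm, hexh, ha',
    hb', hτ, hlink, hsq⟩ := hR R hRmem ρ hρ N δ S T n n' q q' hδ hfam hgates ε' hε'pos φ hφ
  have hktop : Tendsto (fun j => φ (ψ j)) atTop atTop := hφ.tendsto_atTop.comp hψ.tendsto_atTop
  have hs : Tendsto (fun j => δ (φ (ψ j))) atTop (𝓝[>] 0) := hδ.comp hktop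
  have hspos : ∀ᶠ j in atTop, 0 < δ (φ (ψ j)) := hs.eventually eventually_mem_nhdsWithin
  have hadm_j := hs.eventually hadm
  have hne_j : ∀ᶠ j in atTop, Nonempty (HexMidEdgeSAW (Λ' (δ (φ (ψ j)))) (a' (δ (φ (ψ j))))
      (b' (δ (φ (ψ j))))) := hadm_j.mono fun j h => h.2.2.2.1
  set νp : ℕ → Measure (CurveClass ℂ) := fun j =>
    (∑ γ : HexMidEdgeSAW (Λ' (δ (φ (ψ j)))) (a' (δ (φ (ψ j)))) (b' (δ (φ (ψ j)))),
      ENNReal.ofReal (hexCriticalFugacity ^ γ.length /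
        (∑ γ' : HexMidEdgeSAW (Λ' (δ (φ (ψ j)))) (a' (δ (φ (ψ j)))) (b' (δ (φ (ψ j)))),
          hexCriticalFugacity ^ γ'.length)) •
        Measure.dirac (CurveClass.mk ⟨polyline (γ.verts.map fun w => ((δ (φ (ψ j)) : ℝ) : ℂ) *
          hexCenter w)⟩) : Measure (CurveClass ℂ)) with hνp
  have hP_j : ∀ᶠ j in atTop, IsProbabilityMeasure (νp j) :=
    hne_j.mono fun j h => isProbabilityMeasure_dcsLaw h
  set w : ℕ → ℂ := fun j => ((δ (φ (ψ j)) : ℝ) : ℂ) * triEmbed (x j) with hw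
  -- THE PER-INDEX TRANSPORT FACTS (positive mesh, nonempty pinned family)
  have hcore : ∀ j, 0 < δ (φ (ψ j)) →
      Nonempty (HexMidEdgeSAW (Λ' (δ (φ (ψ j)))) (a' (δ (φ (ψ j)))) (b' (δ (φ (ψ j))))) →
      (∀ g : CurveClass ℂ →ᵇ ℝ,
        |(∫ ξ, g ξ.curve ∂(carvedLaw D.carrier (δ (φ (ψ j)))
            (S (φ (ψ j)) (n (φ (ψ j))) ∪ T (φ (ψ j)) (n' (φ (ψ j)))) (q (φ (ψ j))) (q' (φ (ψ j))))) -
          ∫ c, g (CurveClass.map ⟨Homeomorph.addRight (w j), (Homeomorph.addRight (w j)).continuous⟩ c)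
            ∂νp j| ≤
        2 * ‖g‖ * (1 - (carvedLaw D.carrier (δ (φ (ψ j)))
            (S (φ (ψ j)) (n (φ (ψ j))) ∪ T (φ (ψ j)) (n' (φ (ψ j)))) (q (φ (ψ j))) (q' (φ (ψ j)))
            {ξ | ∀ w ∈ ξ.walk.support, w ∈ Λ'' j}).toReal)) ∧
      (∀ (𝒞 𝒞' : Set (CurveClass ℂ)),
        (∀ c, CurveClass.map ⟨Homeomorph.addRight (w j), (Homeomorph.addRight (w j)).continuous⟩ c ∈ 𝒞 →
          c ∈ 𝒞') →
        ∀ η : ℝ, 0 ≤ η →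
        carvedLaw D.carrier (δ (φ (ψ j))) (S (φ (ψ j)) (n (φ (ψ j))) ∪ T (φ (ψ j)) (n' (φ (ψ j))))
            (q (φ (ψ j))) (q' (φ (ψ j))) {ξ | ξ.curve ∉ 𝒞} ≤
          ENNReal.ofReal η * carvedLaw D.carrier (δ (φ (ψ j)))
            (S (φ (ψ j)) (n (φ (ψ j))) ∪ T (φ (ψ j)) (n' (φ (ψ j)))) (q (φ (ψ j))) (q' (φ (ψ j)))
            {ξ | ∀ w ∈ ξ.walk.support, w ∈ Λ'' j} →
        (∑ γ : HexMidEdgeSAW (Λ' (δ (φ (ψ j)))) (a' (δ (φ (ψ j)))) (b' (δ (φ (ψ j)))),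
            if CurveClass.mk ⟨polyline (γ.verts.map fun w => ((δ (φ (ψ j)) : ℝ) : ℂ) * hexCenter w)⟩ ∉ 𝒞'
            then hexCriticalFugacity ^ γ.length else 0) ≤
          η * ∑ γ : HexMidEdgeSAW (Λ' (δ (φ (ψ j)))) (a' (δ (φ (ψ j)))) (b' (δ (φ (ψ j)))),
            hexCriticalFugacity ^ γ.length) := by
    intro j hδj hnej
    obtain ⟨hrel, hΛS, hedge, hqmem, hpu, hpv, hadj, hne, hmapa, hmapb⟩ := hlink j
    haveI : Finite (HexDomainSAW D.carrier (δ (φ (ψ j))) (q (φ (ψ j))) (q' (φ (ψ j)))) :=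
      finite_hexDomainSAW D.isBounded hδj.ne' _ _
    haveI := Fintype.ofFinite (HexDomainSAW D.carrier (δ (φ (ψ j))) (q (φ (ψ j))) (q' (φ (ψ j))))
    haveI := hprob (φ (ψ j))
    exact ⟨fun g => core_transport hΛS hedge hqmem hpu hpv hadj hne hrel hmapa hmapb hnej g,
      fun 𝒞 𝒞' h𝒞 η hη h => core_transport_event hΛS hedge hqmem hpu hpv hadj hne hrel hmapa hmapb
        𝒞 𝒞' h𝒞 hη h⟩
  -- (i) the carved integrals are close to the translated pinned integrals, eventually
  have hI : ∀ᶠ j in atTop,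
      |(∫ ξ, f ξ.curve ∂(carvedLaw D.carrier (δ (φ (ψ j)))
          (S (φ (ψ j)) (n (φ (ψ j))) ∪ T (φ (ψ j)) (n' (φ (ψ j)))) (q (φ (ψ j))) (q' (φ (ψ j))))) -
        ∫ c, f (CurveClass.map ⟨Homeomorph.addRight (w j), (Homeomorph.addRight (w j)).continuous⟩ c)
          ∂νp j| ≤ 2 * ‖f‖ * ε' := by
    filter_upwards [hspos, hne_j, hsq] with j hδj hnej hsqj
    refine ((hcore j hδj hnej).1 f).trans ?_
    exact mul_le_mul_of_nonneg_left (by linarith) (by positivity)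
  -- (ii) the pinned laws are eventually uniformly tight
  have htight_j : ∀ η : ℝ, 0 < η → ∃ K : Set (CurveClass ℂ), IsCompact K ∧ ∀ᶠ j in atTop,
      νp j Kᶜ ≤ ENNReal.ofReal η := by
    intro η hη
    have hη' : 0 < η * (1 - ε') := by
      exact mul_pos hη (by linarith)
    obtain ⟨𝒦, h𝒦, hev⟩ := htight (η * (1 - ε')) hη'
    set F : CurveClass ℂ × ℂ → CurveClass ℂ := fun p =>
      CurveClass.map ⟨Homeomorph.addRight p.2, (Homeomorph.addRight p.2).continuous⟩ p.1 with hF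
    refine ⟨F '' (𝒦 ×ˢ closedBall (-τ) 1),
      (h𝒦.prod (isCompact_closedBall _ _)).image continuous_translate_uncurry, ?_⟩
    have hwev : ∀ᶠ j in atTop, dist (w j) τ < 1 := Metric.tendsto_nhds.1 hτ 1 one_pos
    have hevk : ∀ᶠ j in atTop, carvedLaw D.carrier (δ (φ (ψ j)))
        (S (φ (ψ j)) (n (φ (ψ j))) ∪ T (φ (ψ j)) (n' (φ (ψ j)))) (q (φ (ψ j))) (q' (φ (ψ j)))
        {ξ | ξ.curve ∉ 𝒦} ≤ ENNReal.ofReal (η * (1 - ε')) := hktop.eventually hev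
    filter_upwards [hspos, hne_j, hsq, hevk, hwev] with j hδj hnej hsqj hevj hwj
    have hZ := dcsMass_pos (Λ := Λ' (δ (φ (ψ j)))) (a := a' (δ (φ (ψ j)))) (b := b' (δ (φ (ψ j)))) hnej
    have key := (hcore j hδj hnej).2 {ξ | ξ ∈ 𝒦} (F '' (𝒦 ×ˢ closedBall (-τ) 1)) (fun c hc => ?_) η hη.le ?_
    · rw [dcsLaw_apply (IsCompact.image (h𝒦.prod (isCompact_closedBall _ _))
        continuous_translate_uncurry).isClosed.isOpen_compl.measurableSet]
      refine ENNReal.ofReal_le_ofReal ((div_le_iff₀ hZ).2 ?_)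
      refine le_trans (le_of_eq (Finset.sum_congr rfl fun γ _ => ?_)) key
      simp only [Set.mem_compl_iff, hF]
    · -- `c + w j ∈ 𝒦` forces `c ∈ F(𝒦 × B̄(-τ, 1))`
      refine ⟨(CurveClass.map ⟨Homeomorph.addRight (w j), (Homeomorph.addRight (w j)).continuous⟩ c,
        -w j), ⟨hc, ?_⟩, ?_⟩
      · rw [mem_closedBall, dist_neg_neg]; exact hwj.le
      · simp only [hF]
        rw [translate_translate, add_neg_cancel, translate_zero]
    · exact le_mul_of_squeeze hη.le (measure_ne_top _ _) hevj hsqj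
  -- (iv) weak subsequential limits of the pinned laws are SLE(8/3) in `M`; translate, compare
  have hident : ∀ (χ : ℕ → ℕ) (μ : Measure (CurveClass ℂ)), StrictMono χ → IsProbabilityMeasure μ →
      (∀ g : CurveClass ℂ →ᵇ ℝ, Tendsto (fun i => ∫ c, g c ∂νp (χ i)) atTop (𝓝 (∫ c, g c ∂μ))) →
      |(∫ c, f (CurveClass.map ⟨Homeomorph.addRight τ, (Homeomorph.addRight τ).continuous⟩ c) ∂μ) -
        ∫ x, f x ∂ν| ≤ ε / 2 := by
    intro χ μ hχ hμ hconv
    haveI := hμ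
    have hχtop : Tendsto χ atTop atTop := hχ.tendsto_atTop
    have hsχ : Tendsto (fun i => δ (φ (ψ (χ i)))) atTop (𝓝[>] 0) := hs.comp hχtop
    have hratio : ∀ g : CurveClass ℂ →ᵇ ℝ, Tendsto (fun i =>
        (∑ γ : HexMidEdgeSAW (Λ' (δ (φ (ψ (χ i))))) (a' (δ (φ (ψ (χ i))))) (b' (δ (φ (ψ (χ i))))),
            hexCriticalFugacity ^ γ.length *
              g (CurveClass.mk ⟨polyline (γ.verts.map fun v =>
                ((δ (φ (ψ (χ i))) : ℝ) : ℂ) * hexCenter v)⟩)) /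
          (∑ γ : HexMidEdgeSAW (Λ' (δ (φ (ψ (χ i))))) (a' (δ (φ (ψ (χ i))))) (b' (δ (φ (ψ (χ i))))),
            hexCriticalFugacity ^ γ.length)) atTop (𝓝 (∫ c, g c ∂μ)) := by
      intro g
      refine (hconv g).congr' ?_
      filter_upwards [hχtop.eventually hne_j] with i hnei
      exact integral_dcsLaw hnei g
    have hmodχ : ∀ ε₁ η₁ : ℝ, 0 < ε₁ → 0 < η₁ → ∃ θ : ℝ, 0 < θ ∧ ∀ᶠ i in atTop,
        (∑ γ : HexMidEdgeSAW (Λ' (δ (φ (ψ (χ i))))) (a' (δ (φ (ψ (χ i))))) (b' (δ (φ (ψ (χ i))))),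
            if CurveClass.mk ⟨polyline (γ.verts.map fun v => ((δ (φ (ψ (χ i))) : ℝ) : ℂ) * hexCenter v)⟩ ∉
                CurveClass.modulusClass ε₁ θ
            then hexCriticalFugacity ^ γ.length else 0) ≤
          η₁ * ∑ γ : HexMidEdgeSAW (Λ' (δ (φ (ψ (χ i))))) (a' (δ (φ (ψ (χ i))))) (b' (δ (φ (ψ (χ i))))),
            hexCriticalFugacity ^ γ.length := by
      intro ε₁ η₁ hε₁ hη₁
      have hη₁' : 0 < η₁ * (1 - ε') := by
        exact mul_pos hη₁ (by linarith)
      obtain ⟨θ, hθ, hev⟩ := hmod ε₁ hε₁ (η₁ * (1 - ε')) hη₁'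
      refine ⟨θ, hθ, ?_⟩
      have hevχ : ∀ᶠ i in atTop, carvedLaw D.carrier (δ (φ (ψ (χ i))))
          (S (φ (ψ (χ i))) (n (φ (ψ (χ i)))) ∪ T (φ (ψ (χ i))) (n' (φ (ψ (χ i)))))
          (q (φ (ψ (χ i)))) (q' (φ (ψ (χ i))))
          {ξ | ξ.curve ∉ CurveClass.modulusClass ε₁ θ} ≤ ENNReal.ofReal (η₁ * (1 - ε')) :=
        (hktop.comp hχtop).eventually hev
      filter_upwards [hχtop.eventually hspos, hχtop.eventually hne_j, hχtop.eventually hsq, hevχ]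
        with i hδi hnei hsqi hevi
      refine (hcore (χ i) hδi hnei).2 (CurveClass.modulusClass ε₁ θ) (CurveClass.modulusClass ε₁ θ)
        (fun c hc => (translate_mem_modulusClass_iff _ ε₁ θ c).1 hc) η₁ hη₁.le ?_
      exact le_mul_of_squeeze hη₁.le (measure_ne_top _ _) hevi hsqi
    have hSLE : IsSLELaw ((8 : ℝ≥0) / 3) M μ :=
      hT2a M ρ' Λ' m a' b' hflat hadm hexh ha' hb' μ (fun i => δ (φ (ψ (χ i)))) hμ hsχ hratio hmodχ
    exact stub_carvedReduction_continuityStep D M τ ηD (ε / 2) f μ ν hcont hbd hpt0 hpt1 hSLE hν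
  obtain ⟨j, -, hj⟩ := exists_close_of_weakLimits νp
    (fun j => ∫ ξ, f ξ.curve ∂(carvedLaw D.carrier (δ (φ (ψ j)))
      (S (φ (ψ j)) (n (φ (ψ j))) ∪ T (φ (ψ j)) (n' (φ (ψ j)))) (q (φ (ψ j))) (q' (φ (ψ j)))))
    (∫ x, f x ∂ν) w τ f (2 * ‖f‖ * ε') (ε / 2) (ε / 8) (by positivity) hP_j htight_j hI hτ hident 0
  exact hbad (ψ j) (by linarith)

end Summit.CriticalPhenomena.SAWScalingLimit.Theorems.ObservableToSLE.TypeLadder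

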